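import Mathlib.Algebra.Group.Hom.End
import Mathlib.Data.ZMod.Basic
import Mathlib.GroupTheory.OrderOfElement
import Summits.MatrixMultiplication.OmegaCensus.BoxBadSmallGroups2

/-!
# ω-census, family (b3): the affine extension `A ⋊_φ ℤ/n` of an additive group by an endomorphism of finite order

HONEST FRAMING (pub-omega census; verbatim): lottery ticket; floor = certified bounds/negative ranges.
Census BOOKKEEPING (conjecture C9 of the cell, STRUCTURE.md §2; pub-omega kernel-l4 gen 18, task K-8 «make the atom hypothesis
unconditional»).  `MetaCyc N q u = ℤ/N ⋊_u ℤ/q` (`MetaCyclic.lean`) and `RCyc R q u = R ⋊_u ℤ/q` (`RingMetaCyclic.lean`) twist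
an additive group by MULTIPLICATION by a ring element.  The relation-form Schmidt atoms (`AtomConfig p q a y`,
`BoxUsefulAtomConfig.lean`) produce an elementary abelian `p`-group `W` with an AUTOMORPHISM `φ` (conjugation by `y`) that is in
general not multiplication by a scalar; this file is the verbatim generalisation of the model to that setting:
* `AffExt A n φ` — pairs `(v : A, t : ZMod n)` with `(v,t)(v',t') = (v + φᵗ v', t + t')`, a group when `φ ^ n = 1`
  (`φ : AddMonoid.End A`), of order `|A| · n` (`AffExt.card`);
* `AffExt.lift` — the universal property: an additive character `e : Multiplicative A →* G` and `y ∈ G` with `y ^ n = 1` and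
  `y e(v) y⁻¹ = e(φ v)` give `(v, t) ↦ e(v) yᵗ`; `AffExt.lift_injective` — injective when `e` is and `yᵗ ∈ e(A)` only for `t = 0`;
  `AffExt.twist_pow_orderOf` — with `e` injective, `φ ^ orderOf y = 1` automatically.
The `3 × 3` box machinery for `AffExt` is `AffineExtensionBox.lean`.  Pure algebra; nothing here is progress on `ω`.
-/

namespace Summit.MatrixMultiplication.OmegaCensus

/-- The split extension `A ⋊_φ ℤ/n` of an additive commutative group `A` by `ℤ/n` acting through the powers of an endomorphism
`φ` with `φ ^ n = 1`: elements `(v, t)`, `v : A`, `t : ZMod n`. [folklore] -/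
structure AffExt (A : Type*) [AddCommGroup A] (n : ℕ) (φ : AddMonoid.End A) where
  /-- the `A`-coordinate -/
  v : A
  /-- the `ℤ/n`-coordinate -/
  t : ZMod n

namespace AffExt

variable {A : Type*} [AddCommGroup A] {n : ℕ} {φ : AddMonoid.End A}

/-- Two elements agree iff both coordinates agree. [folklore] -/
@[ext] theorem ext {x y : AffExt A n φ} (hv : x.v = y.v) (ht : x.t = y.t) : x = y := by
  cases x; cases y; congr

/-- Decidable equality from that of `A`. [folklore] -/
instance [DecidableEq A] : DecidableEq (AffExt A n φ) := fun x y =>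
  decidable_of_iff (x.v = y.v ∧ x.t = y.t) ⟨fun h => ext h.1 h.2, fun h => by subst h; exact ⟨rfl, rfl⟩⟩

/-- `φᵗ` for an exponent `t : ZMod n` (through `t.val`). [folklore] -/
def act (φ : AddMonoid.End A) (t : ZMod n) : AddMonoid.End A := φ ^ t.val

/-- `(v,t)(v',t') = (v + φᵗ v', t + t')`. [folklore] -/
instance : Mul (AffExt A n φ) := ⟨fun x y => ⟨x.v + act φ x.t y.v, x.t + y.t⟩⟩

/-- Identity `(0, 0)`. [folklore] -/
instance : One (AffExt A n φ) := ⟨⟨0, 0⟩⟩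

/-- Inverse `(v,t)⁻¹ = (−φ^{−t} v, −t)`. [folklore] -/
instance : Inv (AffExt A n φ) := ⟨fun x => ⟨-(act φ (-x.t) x.v), -x.t⟩⟩

/-- The multiplication rule, unfolded. [folklore] -/
theorem mul_def (x y : AffExt A n φ) : x * y = ⟨x.v + act φ x.t y.v, x.t + y.t⟩ := rfl
/-- The identity, unfolded. [folklore] -/
theorem one_def : (1 : AffExt A n φ) = ⟨0, 0⟩ := rfl
/-- The inverse, unfolded. [folklore] -/
theorem inv_def (x : AffExt A n φ) : x⁻¹ = ⟨-(act φ (-x.t) x.v), -x.t⟩ := rfl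

/-- `(f * g) v = f (g v)` in `AddMonoid.End A`. [folklore] -/
theorem end_mul_apply (f g : AddMonoid.End A) (v : A) : (f * g) v = f (g v) := rfl

/-- `φ ^ n = 1` makes `t ↦ φᵗ` multiplicative on `ZMod n`. [folklore] -/
theorem act_add [NeZero n] (hφ : φ ^ n = 1) (s t : ZMod n) : act φ (s + t) = act φ s * act φ t := by
  unfold act
  rw [ZMod.val_add, ← pow_add]
  conv_rhs => rw [← Nat.mod_add_div (s.val + t.val) n, pow_add, pow_mul, hφ, one_pow, mul_one]

/-- `φ⁰ = 1`. [folklore] -/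
theorem act_zero : act φ (0 : ZMod n) = 1 := by
  unfold act; rw [ZMod.val_zero, pow_zero]

/-- `φˢ (φᵗ v) = φ^{s+t} v`. [folklore] -/
theorem act_act [NeZero n] (hφ : φ ^ n = 1) (s t : ZMod n) (v : A) : act φ s (act φ t v) = act φ (s + t) v := by
  rw [act_add hφ, end_mul_apply]

/-- `φ⁰ v = v`. [folklore] -/
theorem act_zero_apply (v : A) : act φ (0 : ZMod n) v = v := by
  rw [act_zero]; rfl

/-- `AffExt A n φ` is a group when `φ ^ n = 1`. [folklore] -/
instance instGroup [NeZero n] [Fact (φ ^ n = 1)] : Group (AffExt A n φ) :=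
  Group.ofLeftAxioms
    (fun x y z => by
      have hφ : φ ^ n = 1 := Fact.out
      apply ext
      · simp only [mul_def, map_add, act_act hφ]
        abel
      · simp only [mul_def]; abel)
    (fun x => by
      apply ext
      · simp only [mul_def, one_def, act_zero_apply, zero_add]
      · simp only [mul_def, one_def, zero_add])
    (fun x => by
      have hφ : φ ^ n = 1 := Fact.out
      apply ext
      · simp only [mul_def, inv_def, one_def, neg_add_cancel]
      · simp only [mul_def, inv_def, one_def, neg_add_cancel])

/-- `AffExt A n φ ≃ A × ZMod n` (as types). [folklore] -/
def equivProd : AffExt A n φ ≃ A × ZMod n :=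
  ⟨fun x => (x.v, x.t), fun p => ⟨p.1, p.2⟩, fun _ => rfl, fun _ => rfl⟩

/-- Finite, through `equivProd`. [folklore] -/
instance [Fintype A] [NeZero n] : Fintype (AffExt A n φ) := Fintype.ofEquiv _ equivProd.symm

/-- `|A ⋊ ℤ/n| = |A| · n`. [folklore] -/
theorem card [Fintype A] [NeZero n] : Fintype.card (AffExt A n φ) = Fintype.card A * n := by
  rw [Fintype.ofEquiv_card, Fintype.card_prod, ZMod.card]

/-! ### The universal property -/

variable {G : Type*} [Group G]

/-- Powers of an element of finite order depend only on the exponent mod the order. [folklore] -/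
theorem pow_val_add [NeZero n] {y : G} (hyn : y ^ n = 1) (s t : ZMod n) :
    y ^ (s + t).val = y ^ s.val * y ^ t.val := by
  rw [ZMod.val_add, ← pow_add]
  conv_rhs => rw [← Nat.mod_add_div (s.val + t.val) n, pow_add, pow_mul, hyn, one_pow, mul_one]

/-- Iterating the twist: `yᵏ e(v) y⁻ᵏ = e(φᵏ v)`. [folklore] -/
theorem conj_pow_eq (e : Multiplicative A →* G) (y : G)
    (hy : ∀ v : A, y * e (Multiplicative.ofAdd v) * y⁻¹ = e (Multiplicative.ofAdd (φ v))) (k : ℕ) (v : A) :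
    y ^ k * e (Multiplicative.ofAdd v) * (y ^ k)⁻¹ = e (Multiplicative.ofAdd ((φ ^ k) v)) := by
  induction k generalizing v with
  | zero => simp
  | succ k ih =>
    rw [pow_succ', mul_inv_rev, show y * y ^ k * e (Multiplicative.ofAdd v) * ((y ^ k)⁻¹ * y⁻¹) =
      y * (y ^ k * e (Multiplicative.ofAdd v) * (y ^ k)⁻¹) * y⁻¹ by group, ih, hy, pow_succ', end_mul_apply]

/-- With `e` injective the twist satisfies `φ ^ orderOf y = 1`. [folklore] -/
theorem twist_pow_orderOf (e : Multiplicative A →* G) (he : Function.Injective e) (y : G)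
    (hy : ∀ v : A, y * e (Multiplicative.ofAdd v) * y⁻¹ = e (Multiplicative.ofAdd (φ v))) : φ ^ orderOf y = 1 := by
  apply AddMonoidHom.ext
  intro v
  have h := conj_pow_eq e y hy (orderOf y) v
  rw [_root_.pow_orderOf_eq_one y, one_mul, inv_one, mul_one] at h
  have := Multiplicative.ofAdd.injective (he h)
  exact this.symm

/-- **Universal property of `A ⋊_φ ℤ/n`.** An additive character `e` of `A` in `G` and `y ∈ G` with `y ^ n = 1` twisting `e`
through `φ` define the homomorphism `(v, t) ↦ e(v) · yᵗ`. [folklore] -/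
def lift [NeZero n] [Fact (φ ^ n = 1)] (e : Multiplicative A →* G) (y : G) (hyn : y ^ n = 1)
    (hy : ∀ v : A, y * e (Multiplicative.ofAdd v) * y⁻¹ = e (Multiplicative.ofAdd (φ v))) : AffExt A n φ →* G where
  toFun x := e (Multiplicative.ofAdd x.v) * y ^ x.t.val
  map_one' := by simp [one_def]
  map_mul' x z := by
    simp only [mul_def]
    rw [pow_val_add hyn, ofAdd_add, map_mul]
    have h := conj_pow_eq e y hy x.t.val z.v
    rw [mul_inv_eq_iff_eq_mul] at h
    calc e (Multiplicative.ofAdd x.v) * e (Multiplicative.ofAdd (act φ x.t z.v)) * (y ^ x.t.val * y ^ z.t.val)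
        = e (Multiplicative.ofAdd x.v) * (y ^ x.t.val * e (Multiplicative.ofAdd z.v) * (y ^ x.t.val)⁻¹) *
            (y ^ x.t.val * y ^ z.t.val) := by rw [conj_pow_eq e y hy]; rfl
      _ = e (Multiplicative.ofAdd x.v) * y ^ x.t.val * (e (Multiplicative.ofAdd z.v) * y ^ z.t.val) := by group

/-- Value of `lift`. [folklore] -/
theorem lift_apply [NeZero n] [Fact (φ ^ n = 1)] (e : Multiplicative A →* G) (y : G) (hyn : y ^ n = 1)
    (hy : ∀ v : A, y * e (Multiplicative.ofAdd v) * y⁻¹ = e (Multiplicative.ofAdd (φ v))) (x : AffExt A n φ) :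
    lift e y hyn hy x = e (Multiplicative.ofAdd x.v) * y ^ x.t.val := rfl

/-- **Injectivity of `lift`**: if `e` is injective and `yᵗ ∈ e(A)` only for `t = 0`, then `lift` is injective. [folklore] -/
theorem lift_injective [NeZero n] [Fact (φ ^ n = 1)] (e : Multiplicative A →* G) (y : G) (hyn : y ^ n = 1)
    (hy : ∀ v : A, y * e (Multiplicative.ofAdd v) * y⁻¹ = e (Multiplicative.ofAdd (φ v)))
    (he : Function.Injective e) (hker : ∀ (t : ZMod n) (v : A), y ^ t.val = e (Multiplicative.ofAdd v) → t = 0) :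
    Function.Injective (lift e y hyn hy) := by
  rw [injective_iff_map_eq_one]
  intro x hx
  rw [lift_apply] at hx
  have hyt : y ^ x.t.val = e (Multiplicative.ofAdd (-x.v)) := by
    rw [ofAdd_neg, map_inv]
    exact eq_inv_of_mul_eq_one_right hx
  have ht : x.t = 0 := hker x.t (-x.v) hyt
  rw [ht, ZMod.val_zero, pow_zero, mul_one] at hx
  have hv : x.v = 0 := by
    have := he (hx.trans (map_one e).symm)
    simpa using this
  exact AffExt.ext hv ht

end AffExt

end Summit.MatrixMultiplication.OmegaCensus
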